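import Summits.QuantumFields.YangMills.Theorems.LuscherReductionTwistedTraceScalingValleyBOWeak
import Summits.QuantumFields.YangMills.Theorems.LuscherReductionTwistedTraceScalingRiccatiZPE
import Summits.QuantumFields.YangMills.Theorems.LuscherReductionTwistedTraceScalingZPEBounds
import Summits.QuantumFields.YangMills.Theorems.LuscherReductionTwistedTraceScalingValleyFloorDoor
import HarnessLib

/-!
# `ValleyBOWeakAt` split into UPPER(N) and FLOOR(N); the UPPER clause from lane B's Riccati chain modulo a scalar tail condition and measurability
# (lane A of S-BASE, crux `TwistedTraceScaling` stmt-QuantumFields-20203; design note `pub/ym-fleet/ym-luscher-20007-p1/COARSE-DESIGN.md` §17)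

* `ValleyBOUpperAt L δ η κ N`, `ValleyFloorAt L δ κ N` — the two clauses of `ValleyBOWeakAt` with an EXPLICIT normalisation `N : ℝ → ℝ` (the whole content of the BO
  sub-target is that ONE `N` serves both); `valleyBOWeakAt_of_upper_floor` — recombination.
* `riccatiPref`, `riccatiGauss` — lane B's `U`-independent prefactor and the Gaussian factor of `…RiccatiZPE` as functions of `(β, ρ, σ, μ)`; `riccatiN = riccatiPref·riccatiGauss`.
* ★★★ `valleyBOUpperAt_of_riccati` — given scale functions `ρ, μ, d_ch : ℝ → ℝ` satisfying lane B's hypotheses eventually, MEASURABILITY of the Riccati trial state (lane B's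
  hypothesis (m5)) and the scalar TAIL CONDITION `∀ ε>0`, evtl. `e^{2β|E|}e^{−2β d_ch} ≤ riccatiN·(εδ)·e^{−Zmax}·e^{−2ĝη}` (`Zmax = 3|E|·modeZPE((10√N)²/2)`, `ĝ = √(t²+2tb'/μ)`),
  the UPPER clause `ValleyBOUpperAt L δ η (1/2) riccatiN` HOLDS with `h = stiffTrial (riccatiWeight (β/2) (β(1+ρ²)⁻²) μ)`, `c = e^{−2ĝη}`, `C_h = 1`.
So `ValleyBOWeakAt L (β^{−p}) (β^{−q})` ⇐ (m5) + TAIL (real asymptotics of explicit functions) + ★ `ValleyFloorAt L (β^{−p}) (1/2) riccatiN` (C3d with lane B's `N`; error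
budget §17.3/§17.6).
HONEST FRAMING: a kernel-checked reduction for a stub lane of a child of the CONDITIONAL reduction route (femto rung R2b1); FLOOR open; not infinite volume, not a gap, not Clay.
-/

set_option autoImplicit false

noncomputable section

open MeasureTheory Real Module Finset
open scoped BigOperators RealInnerProductSpace
open Literature.MathematicalPhysics.QuantumFieldTheory
open Literature.MathematicalPhysics.QuantumLattice

namespace Summit.QuantumFields.YangMills.Theorems.FemtoTransferGap

open TwoLattice TwoLattice.Toron TwoLattice.Cov TwoLattice.Stiff TwoLattice.Harm TwoLattice.GnChart

variable (L : ℕ) [NeZero L]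

/-! ## §1 The split -/

/-- **UPPER(N)**: the super-solution clause of `ValleyBOWeakAt` with explicit normalisation `N(β)`. [cite: Luscher1983, §3] -/
def ValleyBOUpperAt (δ η : ℝ → ℝ) (κ : ℝ) (N : ℝ → ℝ) : Prop :=
  ∀ ε : ℝ, 0 < ε → ∃ β0 : ℝ, ∀ β : ℝ, β0 ≤ β →
    ∃ (h : GaugeConfig 3 L SU2 → ℝ) (c Ch : ℝ), Measurable h ∧ 0 < c ∧ (∀ U, 0 ≤ h U) ∧ (∀ U, h U ≤ Ch) ∧
      (∀ U ∈ valleySet L (δ β) (η β), c ≤ h U) ∧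
      ∀ U ∈ valleySet L (δ β) (η β), transferApply β h U ≤ N β * Real.exp (ε * δ β) * Real.exp (-zpeSum L κ U) * h U

/-- **FLOOR(N)**: the k = 0 floor clause of `ValleyBOWeakAt` with explicit normalisation `N(β)` (C3d). [cite: Luscher1983, §3] -/
def ValleyFloorAt (δ : ℝ → ℝ) (κ : ℝ) (N : ℝ → ℝ) : Prop :=
  ∀ ε : ℝ, 0 < ε → ∃ β0 : ℝ, ∀ β : ℝ, β0 ≤ β → N β * Real.exp (-(6 * toronZPE L κ 0 0)) * Real.exp (-(ε * δ β)) ≤ levelValue su2Rep L β 0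

variable {L}

/-- **Recombination**: UPPER(N) ∧ FLOOR(N) with the SAME positive `N` and `κ > 0` give `ValleyBOWeakAt`. [cite: Luscher1983, §3] -/
theorem valleyBOWeakAt_of_upper_floor {δ η : ℝ → ℝ} {κ : ℝ} {N : ℝ → ℝ} (hκ : 0 < κ) (hN : ∀ β, 0 < N β)
    (hU : ValleyBOUpperAt L δ η κ N) (hF : ValleyFloorAt L δ κ N) : ValleyBOWeakAt L δ η := by
  refine ⟨κ, hκ, fun ε hε => ?_⟩
  obtain ⟨βU, hβU⟩ := hU ε hε
  obtain ⟨βF, hβF⟩ := hF ε hε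
  refine ⟨max βU βF, fun β hβ => ⟨N β, hN β, hβF β ((le_max_right _ _).trans hβ), ?_⟩⟩
  obtain ⟨h, c, Ch, hhm, hc, hh0, hhC, hhc, hrow⟩ := hβU β ((le_max_left _ _).trans hβ)
  exact ⟨h, c, Ch, hhm, hc, hh0, hhC, hhc, hrow⟩

/-! ## §2 Lane B's normalisation as a function of the scales -/

/-- Lane B's `U`-independent prefactor `(2π²)^{−|E|} e^{2β|E|} e^{(β/2)(η₁+θ)} e^{E}` at `(β, ρ, σ, μ)`. [cite: Luscher1983, §3] -/
def riccatiPref (L : ℕ) [NeZero L] (β ρ σ μ : ℝ) : ℝ :=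
  ((2 * π ^ 2)⁻¹) ^ Fintype.card (Edge 3 L) * Real.exp (2 * β) ^ Fintype.card (Edge 3 L) *
    Real.exp (β / 2 * (stepErrLo ρ σ (Fintype.card (Plaquette 3 L × Fin 3)) + chartErr ρ σ (Fintype.card (Plaquette 3 L × Fin 3)))) *
    Real.exp (trialErr ρ σ (Fintype.card (Plaquette 3 L × Fin 3)) (Fintype.card (Edge 3 L × Fin 3))
      (Real.sqrt ((β / 2) ^ 2 + 2 * (β / 2) * (β / (1 + ρ ^ 2) ^ 2) / μ) / μ)
      (Real.sqrt ((β / 2) ^ 2 + 2 * (β / 2) * (β / (1 + ρ ^ 2) ^ 2) / μ))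
      (3 * (β / 2) / μ ^ 2 + 3 * (β / (1 + ρ ^ 2) ^ 2) / μ ^ 3))

/-- The Gaussian factor `√(π/b')^{3|E|}·e^{3|E|·modeZPE((β/2)μ/b')}`, `b' = β/(1+ρ²)²`. [cite: Wipf2021, §8.5.1] -/
def riccatiGauss (L : ℕ) [NeZero L] (β ρ μ : ℝ) : ℝ :=
  Real.sqrt (Real.pi / (β / (1 + ρ ^ 2) ^ 2)) ^ (Fintype.card (Edge 3 L) * 3) *
    Real.exp ((Fintype.card (Edge 3 L) * 3 : ℕ) * modeZPE (β / 2 * μ / (β / (1 + ρ ^ 2) ^ 2)))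

/-- Lane B's normalisation `N_B = riccatiPref · riccatiGauss`. [cite: Luscher1983, §3] -/
def riccatiN (L : ℕ) [NeZero L] (β ρ σ μ : ℝ) : ℝ := riccatiPref L β ρ σ μ * riccatiGauss L β ρ μ

/-- `riccatiPref > 0`. [folklore] -/
theorem riccatiPref_pos (β ρ σ μ : ℝ) : 0 < riccatiPref L β ρ σ μ := by unfold riccatiPref; positivity

/-- `riccatiGauss > 0` for `β > 0`. [folklore] -/
theorem riccatiGauss_pos {β : ℝ} (hβ : 0 < β) (ρ μ : ℝ) : 0 < riccatiGauss L β ρ μ := by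
  unfold riccatiGauss
  have : 0 < Real.sqrt (Real.pi / (β / (1 + ρ ^ 2) ^ 2)) := Real.sqrt_pos.2 (by positivity)
  positivity

/-- `riccatiN > 0` for `β > 0`. [folklore] -/
theorem riccatiN_pos {β : ℝ} (hβ : 0 < β) (ρ σ μ : ℝ) : 0 < riccatiN L β ρ σ μ :=
  mul_pos (riccatiPref_pos β ρ σ μ) (riccatiGauss_pos hβ ρ μ)

/-- `…RiccatiZPE` restated with the named normalisation: `(K H)(U) ≤ riccatiN·e^{−zpeSum L (1/2) U}·H(U) + e^{2β|E|}e^{−2βδ}`. [cite: Luscher1983, §3] [cite: Wipf2021, §8.5.2] -/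
theorem transferApply_riccatiTrial_le_riccatiN {β δ ρ σ μ : ℝ} (hβ : 0 < β) (hδ : δ < 1) (hρ0 : 0 ≤ ρ) (hρ : ρ ≤ 1 / 100)
    (hρδ : ((1 - δ) ^ 2)⁻¹ - 1 ≤ ρ ^ 2) (hσ : σ ≤ 1 / 16) (hμ : 0 < μ)
    (hH : Measurable (stiffTrial (L := L) (riccatiWeight (β / 2) (β / (1 + ρ ^ 2) ^ 2) μ))) (U : GaugeConfig 3 L SU2)
    (hS : wilsonAction su2Rep U ≤ σ) :
    transferApply β (stiffTrial (riccatiWeight (β / 2) (β / (1 + ρ ^ 2) ^ 2) μ)) U ≤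
      riccatiN L β ρ σ μ * Real.exp (-zpeSum L (1 / 2) U) * stiffTrial (riccatiWeight (β / 2) (β / (1 + ρ ^ 2) ^ 2) μ) U +
        Real.exp (2 * β) ^ Fintype.card (Edge 3 L) * Real.exp (-(2 * β * δ)) := by
  have h := transferApply_riccatiTrial_le_zpe hβ hδ hρ0 hρ hρδ hσ hμ hH U hS
  simp only [riccatiN, riccatiPref, riccatiGauss]
  convert h using 2
  ring

/-! ## §3 ★★★ The UPPER clause from lane B's chain -/

/-- ★★★ **UPPER(riccatiN) FROM LANE B'S RICCATI CHAIN.**  Scale functions `ρ, μ, d : ℝ → ℝ` with, eventually in `β`: `0 < β`, `d β < 1`, `0 ≤ ρ β ≤ 1/100`,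
`(1 − d β)⁻² − 1 ≤ ρ β²`, `0 < η β`, `2η β ≤ 1/16`, `0 < μ β`, the Riccati trial state MEASURABLE (lane B (m5)), and the scalar TAIL CONDITION: `∀ ε > 0`, eventually
`e^{2β|E|} e^{−2β d} ≤ riccatiN · (ε δ β) · e^{−3|E|·modeZPE((10√N)²/2)} · e^{−ĝ·2η β}` (`ĝ = √((β/2)² + β²(1+ρ²)⁻²/μ)`).  Then `ValleyBOUpperAt L δ η (1/2) riccatiN`.
[cite: Luscher1983, §3] [cite: Wipf2021, §8.5.2] -/
theorem valleyBOUpperAt_of_riccati {δ η : ℝ → ℝ} (ρ μ d : ℝ → ℝ)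
    (hyp : ∃ β1 : ℝ, ∀ β : ℝ, β1 ≤ β → 0 < β ∧ d β < 1 ∧ 0 ≤ ρ β ∧ ρ β ≤ 1 / 100 ∧ ((1 - d β) ^ 2)⁻¹ - 1 ≤ ρ β ^ 2 ∧ 0 < η β ∧
      2 * η β ≤ 1 / 16 ∧ 0 < μ β ∧ Measurable (stiffTrial (L := L) (riccatiWeight (β / 2) (β / (1 + ρ β ^ 2) ^ 2) (μ β))))
    (htail : ∀ ε : ℝ, 0 < ε → ∃ β2 : ℝ, ∀ β : ℝ, β2 ≤ β →
      Real.exp (2 * β) ^ Fintype.card (Edge 3 L) * Real.exp (-(2 * β * d β)) ≤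
        riccatiN L β (ρ β) (2 * η β) (μ β) * (ε * δ β) *
          Real.exp (-((Fintype.card (Edge 3 L) * 3 : ℕ) * modeZPE (1 / 2 * (10 * Real.sqrt (Fintype.card (Plaquette 3 L × Fin 3))) ^ 2))) *
          Real.exp (-(Real.sqrt ((β / 2) ^ 2 + 2 * (β / 2) * (β / (1 + ρ β ^ 2) ^ 2) / μ β) * (2 * η β)))) :
    ValleyBOUpperAt L δ η (1 / 2) (fun β => riccatiN L β (ρ β) (2 * η β) (μ β)) := by
  intro ε hε
  obtain ⟨β1, h1⟩ := hyp
  obtain ⟨β2, h2⟩ := htail ε hε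
  refine ⟨max β1 β2, fun β hβ => ?_⟩
  obtain ⟨hβ0, hd1, hρ0, hρ1, hρd, hη0, hη, hμ0, hmeas⟩ := h1 β ((le_max_left _ _).trans hβ)
  have ht := h2 β ((le_max_right _ _).trans hβ)
  set t : ℝ := β / 2 with htdef
  set b' : ℝ := β / (1 + ρ β ^ 2) ^ 2 with hb'
  set ĝ : ℝ := Real.sqrt (t ^ 2 + 2 * t * b' / μ β) with hĝ
  set H := stiffTrial (L := L) (riccatiWeight t b' (μ β)) with hH
  set c : ℝ := Real.exp (-(ĝ * (2 * η β))) with hc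
  set Zmax : ℝ := ((Fintype.card (Edge 3 L) * 3 : ℕ) : ℝ) * modeZPE (1 / 2 * (10 * Real.sqrt (Fintype.card (Plaquette 3 L × Fin 3))) ^ 2) with hZ
  set N : ℝ := riccatiN L β (ρ β) (2 * η β) (μ β) with hN
  have hNpos : 0 < N := riccatiN_pos hβ0 _ _ _
  have ht0 : 0 ≤ t := by positivity
  have hb0 : 0 ≤ b' := by positivity
  have hg0 : ∀ s, 0 ≤ riccatiWeight t b' (μ β) s := fun s => riccatiWeight_nonneg hμ0 s
  refine ⟨H, c, 1, hmeas, Real.exp_pos _, fun U => (stiffTrial_pos _ U).le, fun U => stiffTrial_le_one hg0 U, fun U hU => ?_, fun U hU => ?_⟩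
  · -- `c ≤ H` on the valley: `S(U) < 2η`
    exact exp_neg_mul_le_stiffTrial_of_le ht0 hb0 hμ0 U ((mem_valleySet_iff.1 hU).1.le)
  · have hS : wilsonAction su2Rep U ≤ 2 * η β := ((mem_valleySet_iff.1 hU).1).le
    have hmain := transferApply_riccatiTrial_le_riccatiN hβ0 hd1 hρ0 hρ1 hρd hη hμ0 hmeas U hS
    -- the tail in the currency `N·(εδ)·e^{−Z(U)}·H(U)`
    have hZU : zpeSum L (1 / 2) U ≤ Zmax := zpeSum_le_card_mul U (by norm_num)
    have hcH : c ≤ H U := exp_neg_mul_le_stiffTrial_of_le ht0 hb0 hμ0 U hS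
    have hc0 : 0 < c := Real.exp_pos _
    have hεδ : ε * δ β ≤ Real.exp (ε * δ β) - 1 := by linarith [Real.add_one_le_exp (ε * δ β)]
    have hT : Real.exp (2 * β) ^ Fintype.card (Edge 3 L) * Real.exp (-(2 * β * d β)) ≤
        N * (Real.exp (ε * δ β) - 1) * Real.exp (-zpeSum L (1 / 2) U) * H U := by
      refine ht.trans ?_
      have h3 : Real.exp (-Zmax) ≤ Real.exp (-zpeSum L (1 / 2) U) := Real.exp_le_exp.2 (neg_le_neg hZU)
      have hεδ0 : 0 ≤ ε * δ β := by
        -- from the tail condition: its left side is positive, so `ε δ β > 0`… we only need `N (εδ) ≤ N (e^{εδ} − 1)`, true either way: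
        by_contra hneg
        push Not at hneg
        have hlhs : 0 < Real.exp (2 * β) ^ Fintype.card (Edge 3 L) * Real.exp (-(2 * β * d β)) := by positivity
        have hrhs : N * (ε * δ β) * Real.exp (-Zmax) * c < 0 := by
          have : N * (ε * δ β) < 0 := mul_neg_of_pos_of_neg hNpos hneg
          have h4 : N * (ε * δ β) * Real.exp (-Zmax) < 0 := mul_neg_of_neg_of_pos this (Real.exp_pos _)
          exact mul_neg_of_neg_of_pos h4 hc0
        linarith
      calc N * (ε * δ β) * Real.exp (-Zmax) * c
          ≤ N * (Real.exp (ε * δ β) - 1) * Real.exp (-Zmax) * c := by gcongr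
        _ ≤ N * (Real.exp (ε * δ β) - 1) * Real.exp (-zpeSum L (1 / 2) U) * H U := by
            have hA : 0 ≤ N * (Real.exp (ε * δ β) - 1) := mul_nonneg hNpos.le (by linarith)
            exact mul_le_mul (mul_le_mul_of_nonneg_left h3 hA) hcH hc0.le (by positivity)
    calc transferApply β H U
        ≤ N * Real.exp (-zpeSum L (1 / 2) U) * H U + Real.exp (2 * β) ^ Fintype.card (Edge 3 L) * Real.exp (-(2 * β * d β)) := hmain
      _ ≤ N * Real.exp (-zpeSum L (1 / 2) U) * H U + N * (Real.exp (ε * δ β) - 1) * Real.exp (-zpeSum L (1 / 2) U) * H U := by linarith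
      _ = N * Real.exp (ε * δ β) * Real.exp (-zpeSum L (1 / 2) U) * H U := by ring

end Summit.QuantumFields.YangMills.Theorems.FemtoTransferGap

end
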